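import Literature.AlgebraicGeometry.Frobenioids.Thm34SubStdHyp
import Literature.AlgebraicGeometry.Frobenioids.PadicFrobenioidStandardType
import Literature.AlgebraicGeometry.Frobenioids.ModelFrobenioidTypeBridge
import Literature.AlgebraicGeometry.Frobenioids.PadicFieldwiseSaturatedPrelim
import Literature.AlgebraicGeometry.Frobenioids.ModelFrobenioidPreSteps
import HarnessLib

/-!
# Frobenioids II, Theorem 1.2 (i) + Frobenioids I, Theorem 3.4 (iii): self-equivalences of a `p`-adic Frobenioid preserve the Frobenius-trivial objects

Mochizuki, *The geometry of Frobenioids II*, Kyushu J. Math. **62** (2008) 401–460, §1, Theorem 1.2 (i), p. 9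
[cite: MochizukiFrdII2008, Thm 1.2 (i) p.9] ("`C` is of … standard type"; "for `A_D ∈ Ob(D)`, the monoid `End_D(A_D)`
acts trivially on `Φ(A_D)`"); Mochizuki, *The geometry of Frobenioids I*, Kyushu J. Math. **62** (2008), Theorem 3.4
(iii), p. 62 [cite: MochizukiFrdI2008, Thm. 3.4 (iii) p.62] ("`Ψ` preserves … isometries … `Ψ^{ℕ_{≥1}}` … is the
identity"). Consumed by [IUTchI] Ex. 3.3 (iii) (d) ("the category `C⊢_v` may be reconstructed category-theoretically
from `F̲_v` [cf. [FrdI], Corollary 4.11, (iii); [FrdII], Theorem 1.2, (i); (a), (c) above]").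

PROOF-ONLY file (abc-iut cell, seat abc-iut-L1-t4; companion of `PadicFrobenioidCdashEssImage.lean`), 0 definitions.
For the `p`-adic Frobenioid `C` of a datum `d` ([FrdII] Ex. 1.1 (ii)) over a base `D` of FSM-type:
* `Datum.exists_isometry_two_of_iso_zeroObj` — an object isomorphic to the Frobenius-trivial object `(A, 0)` over its
  base carries an ISOMETRIC endomorphism of Frobenius degree `2` (the transport of `(2, id, 0, 0)`);
* `Datum.nonempty_iso_zeroObj_of_isometry_two` — conversely, an object `(A, α)` with an isometric endomorphism of
  Frobenius degree `2` is isomorphic to `(A, 0)`: `End_D(A)` acts trivially on `Φ(A)^gp` (`Datum.pullGp_endo`), so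
  relation (d) of [FrdI] Thm. 5.2 (i) reads `2α = α + Div_B(u)`, i.e. `α = Div_B(u)`;
* **`Datum.nonempty_iso_zeroObj_map_equivalence`** — hence every self-equivalence `e` of `C` carries objects
  isomorphic to `(Base, 0)` to objects isomorphic to `(Base, 0)`: by [FrdI] Thm. 3.4 (iii) over FSM-type bases
  (abc-iut-L1's `FrdI.Thm34Sub.l01_morphismsPreserved_FSM_holds` — isometries are preserved — and
  `l07_psiN_nonGroupLike_holds` — `Ψ^{ℕ_{≥1}} = id`), whose hypotheses hold for `C` by Thm. 1.2 (i) (standard type,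
  not group-like; the argument of abc-iut-w4-d047's `GoodLocalFrobenioidOfKitQpCdash.lean` at `K_v = ℚ_p`, here over an
  arbitrary FSM-type base).
With `PadicFrobenioidCdashEssImage.lean` this reduces the input `hobj` of the reconstructibility socket for
[IUTchI] Ex. 3.3 (iii) (d) to its anabelian core: the base self-equivalence induced by a self-equivalence of `C_v`
preserves the image of `D_v^⊢ ⊆ D_v`. No statement of the paper is strengthened; nothing here bears on [IUTchIII].
-/

namespace Literature.AlgebraicGeometry.Frobenioids

namespace PadicFrd

namespace Datum

open CategoryTheory Opposite

universe v u

variable {D : Type u} [Category.{v} D] {p : ℕ} [Fact p.Prime] (d : Datum D p)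

/-- An object of the `p`-adic Frobenioid isomorphic to the Frobenius-trivial object `(A, 0)` over its base carries an
isometric endomorphism of Frobenius degree `2` (the conjugate of the Frobenius endomorphism `(2, id, 0, 0)` of
`(A, 0)`, [FrdI] Thm. 5.2 (iii)). [cite: MochizukiFrdI2008, Thm. 5.2(i) p.100] -/
theorem exists_isometry_two_of_iso_zeroObj (Z : d.frobenioid)
    (hZ : Nonempty (Z ≅ ModelFrobenioid.zeroObj d.Φ d.B d.divB Z.base)) :
    ∃ φ : Z ⟶ Z, ModelFrobenioid.degFr φ = 2 ∧ ModelFrobenioid.div φ = 1 := by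
  obtain ⟨i⟩ := hZ
  have hΦd : Objectwise (fun M _ => IsDivisorial M) d.Φ := fun A => (d.isMonoprime (op A)).isDivisorial
  refine ⟨i.hom ≫ ModelFrobenioid.zeroHom 2 (𝟙 Z.base) ≫ i.inv, ?_, ?_⟩
  · rw [ModelFrobenioid.degFr_comp, ModelFrobenioid.degFr_comp, ModelFrobenioid.degFr_eq_one_of_isIso i.hom,
      ModelFrobenioid.degFr_eq_one_of_isIso i.inv, mul_one, one_mul]
    rfl
  · rw [ModelFrobenioid.div_comp_of_isIso' hΦd i.hom, ModelFrobenioid.div_comp_of_isIso hΦd _ i.inv]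
    exact map_one (pull d.Φ (ModelFrobenioid.baseMap i.hom))

/-- An object `(A, α)` of the `p`-adic Frobenioid with an isometric endomorphism `ψ` of Frobenius degree `2` is
isomorphic to `(A, 0)`: `End_D(A)` acts trivially on `Φ(A)^gp` (Thm. 1.2 (i), `Datum.pullGp_endo`), so the relation
of `ψ` reads `2α = α + Div_B(u_ψ)`, i.e. `α = Div_B(u_ψ)`, and `(1, id, 0, u_ψ) : (A, α) → (A, 0)` is an isomorphism.
[cite: MochizukiFrdII2008, Thm 1.2 (i) p.9] -/
theorem nonempty_iso_zeroObj_of_isometry_two (W : d.frobenioid) (ψ : W ⟶ W)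
    (hd : ModelFrobenioid.degFr ψ = 2) (hi : ModelFrobenioid.div ψ = 1) :
    Nonempty (W ≅ ModelFrobenioid.zeroObj d.Φ d.B d.divB W.base) := by
  have hrel := ModelFrobenioid.rel ψ
  rw [hd, hi, map_one, mul_one, d.pullGp_endo] at hrel
  have hcls : W.cls = Frobenioids.divB d.Φ d.B d.divB (op W.base) (ModelFrobenioid.unit ψ) := by
    have h2 : W.cls ^ ((2 : ℕ+) : ℕ) = W.cls * W.cls := pow_two W.cls
    exact mul_left_cancel (h2.symm.trans hrel)
  let χ : W ⟶ ModelFrobenioid.zeroObj d.Φ d.B d.divB W.base :=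
    ModelFrobenioid.mkHom W _ 1 (𝟙 W.base) 1 (ModelFrobenioid.unit ψ) (by
      rw [PNat.one_coe, pow_one, map_one, mul_one, pullGp_id]
      exact hcls.trans (one_mul _).symm)
  haveI : IsIso (ModelFrobenioid.baseMap χ) := (inferInstance : IsIso (𝟙 W.base))
  haveI := ModelFrobenioid.isIso_of d.objectwise_isGroupLike_B χ rfl rfl
  exact ⟨asIso χ⟩

/-- **Self-equivalences of a `p`-adic Frobenioid over an FSM-type base preserve the Frobenius-trivial objects**: if
`Z ≅ (Base Z, 0)` then `e(Z) ≅ (Base e(Z), 0)` for every self-equivalence `e` of `C` — [FrdI] Thm. 3.4 (iii) (over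
FSM-type bases: isometries and Frobenius degrees are preserved; its hypotheses hold by [FrdII] Thm. 1.2 (i): `C` is a
Frobenioid of standard type and has no group-like object) carries the degree-`2` isometric endomorphism of `Z` to one
of `e(Z)`. [cite: MochizukiFrdI2008, Thm. 3.4 (iii) p.62] -/
theorem nonempty_iso_zeroObj_map_equivalence (hD : IsOfFSMType D) (e : d.frobenioid ≌ d.frobenioid)
    (Z : d.frobenioid) (hZ : Nonempty (Z ≅ ModelFrobenioid.zeroObj d.Φ d.B d.divB Z.base)) :
    Nonempty (e.functor.obj Z ≅ ModelFrobenioid.zeroObj d.Φ d.B d.divB (e.functor.obj Z).base) := by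
  -- the hypotheses of [FrdI] Thm. 3.4 (iii) (FSM-type variant) for `C` and `e` ([FrdII] Thm. 1.2 (i))
  have hstd : FrdI.Thm34Sub.StdHyp d.structureFunctor d.structureFunctor e :=
    { isFrobenioid₁ := d.isFrobenioid_of_isOfFSMType hD
      isFrobenioid₂ := d.isFrobenioid_of_isOfFSMType hD
      fsm₁ := hD
      fsm₂ := hD
      standard₁ := d.thm12_isOfStandardType_of_isOfFSMType hD
      standard₂ := d.thm12_isOfStandardType_of_isOfFSMType hD
      hypB := fun hg _ =>
        absurd ((ModelFrobenioid.data_isOfGroupLikeType_iff d.Φ d.B d.divB).mp hg) d.not_isZeroMonoid }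
  have hng : ∃ A : d.frobenioid,
      ¬ (PreFrobenioidData.ofFunctor d.Φ d.structureFunctor).IsGroupLikeObj A :=
    ⟨Z, d.thm12_not_isGroupLikeObj Z⟩
  have hf := FrdI.Thm34Sub.fsmHyp_of_stdHyp _ _ e hstd hng hng
  have hiso := (FrdI.Thm34Sub.l01_morphismsPreserved_FSM_holds _ _ e hf).2.2.2.2.2.1
  obtain ⟨ΨN, hΨN, hN⟩ := FrdI.Thm34Sub.l07_psiN_nonGroupLike_holds _ _ e hf
  -- transport the degree-2 isometric endomorphism of `Z`
  obtain ⟨φ, hφd, hφi⟩ := d.exists_isometry_two_of_iso_zeroObj Z hZ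
  have hψd : ModelFrobenioid.degFr (e.functor.map φ) = 2 := by
    have h := hΨN φ
    rw [hN] at h
    change ModelFrobenioid.degFr (e.functor.map φ) = ModelFrobenioid.degFr φ at h
    rw [h, hφd]
  have hψi : ModelFrobenioid.div (e.functor.map φ) = 1 := hiso φ hφi
  exact d.nonempty_iso_zeroObj_of_isometry_two _ (e.functor.map φ) hψd hψi

end Datum

end PadicFrd

end Literature.AlgebraicGeometry.Frobenioids
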